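import Summits.HodgeConjecture.CorCM.AndreProductFormHolds
import Literature.AlgebraicGeometry.Milne1999.WeilClassStabilizer
import HarnessLib

/-!
# COR-CM (cell `pub-hodgecm2`): Deligne's original form of André's theorem, `G^H = G^W` (Milne 2020 Thm. 2 =
# Deligne 1982 §5), with NO hypothesis

HONEST FRAMING (cell pub-hodgecm2 / COR-CM, literature seat lit-andre, gen 21; count-neutral for the binder table,
no row).  A STRUCTURE theorem about the Hodge group of a CM-typed product of abelian varieties; no case of the
Hodge conjecture is proved here.  Theorems only: no definition, no named fact, no instance, no `sorry`.

The source, verbatim (Milne, *Hodge classes on abelian varieties* (2020), §4 «Deligne's original version of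
Theorem 1», held `paper:arxiv-2010.08857` p. 6): «Let `E` be a CM-field Galois over `ℚ`, and let `𝒮` be the set
of CM-types on `E`. For each `Φ ∈ 𝒮` choose an abelian variety `A_Φ` of CM-type `(E,Φ)`, and let
`A_𝒮 = ∏_{Φ∈𝒮} A_Φ`. Define `G^H` (resp. `G^W`) to be the algebraic subgroup of `GL_{H¹(A_𝒮,ℚ)}` fixing all
Hodge classes (resp. divisor classes and split Weil classes) on all products of powers of the `A_Φ`, `Φ ∈ 𝒮`.
**Theorem 2.** The algebraic groups `G^H` and `G^W` are equal. […] **Remark 1.** Theorem 2 is Deligne's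
original theorem (1982, 5) except that, instead of requiring `G^W` to fix all divisor classes, he requires it to
fix certain specific homomorphisms.»

The Literature file `Milne1999/WeilClassStabilizer.lean` (this seat, gen 9) types `G^W(ℂ)` on the tree's
carriers — `Milne1999.weilStabilizer A Φ ι m X`, the subgroup of `∏ₖ GL(Hᵏ(X(ℂ); ℂ))` whose Künneth extension
fixes the Lefschetz classes and the pulled-back split-Weil-line classes on all powers — and PROVES Theorem 2 for
every CM-typed product `B = ⨁_{i<n} A_i` over one Galois CM field `K`
(`Milne1999.hodgeGroup_eq_weilStabilizer`) GRANTED André's theorem in product form, the Literature record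
`HodgeTheory.Andre1992_hodgeClasses_cmTypedProduct_mem_span_pullback_weilLines` (hypothesis `h𝔄`).  That
record is a theorem of the tree — `AndreProductForm.andre1992_hodgeClasses_cmTypedProduct_mem_span_pullback_weilLines_holds`
(`CorCM/AndreProductFormHolds.lean`, this seat gen 2: André's trick on realisations).  This file feeds the one
into the other, so that Theorem 2 and its two corollaries display NO hypothesis beyond the realisation data
`hA : ∀ i, IsCMTypeRealisation (Φ i) (A i) (ι i) (θ i)`:

* `AndreProductForm.hodgeGroup_eq_weilStabilizer` — **`G^H = G^W`**: `hodgeGroup (⨁ A).dim (⨁ A).X =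
  weilStabilizer A Φ ι (⨁ A).dim (⨁ A).X`.
* `AndreProductForm.mumfordTateGroup_eq_weilSimilitudeGroup` — the same in the `GL × 𝔾_m` convention.
* `AndreProductForm.forall_mem_weilStabilizer_apply_eq_iff` — a class is fixed by `G^W(ℂ)` iff it is fixed by
  the Hodge group.
* `AndreProductForm.hodgeGroup_le_weilStabilizer_le_specialLefschetzGroup` — the chain `Hg′(B) = G^W ≤ S(B)`.

The proofs live under `Summits/` because `Literature/` may not import the CorCM assembly.

## References

* [Milne2020HodgeClassesAV] J. S. Milne, *Hodge classes on abelian varieties* (2020) — §4 Theorem 2, Remark 1.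
* [Deligne1982HodgeCycles] P. Deligne, *Hodge cycles on abelian varieties* (notes by J. S. Milne), LNM 900
  (1982) — §5; re-edition, endnote M.12 (p. 64).
* [Andre1992HodgeCM] Y. André, *Une remarque à propos des cycles de Hodge de type CM*, Progr. Math. 102 (1992)
  1–7 — Théorème (pp. 4–5).
* [Milne1999LefschetzClasses] J. S. Milne, *Lefschetz classes on abelian varieties*, Duke Math. J. 96 (1999) —
  Def. 4.3, Prop. 4.8.

Provenance: cell `pub-hodgecm2` (COR-CM), seat lit-andre gen 21 (`HOME/lit/andre.md` v1.10, row A92-G).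
-/

noncomputable section

open CategoryTheory CategoryTheory.Limits NumberField
open Literature.AlgebraicGeometry Literature.AlgebraicGeometry.Motives Literature.AlgebraicGeometry.HodgeTheory
open Literature.AlgebraicGeometry.ComplexMultiplication Literature.AlgebraicGeometry.Milne1999
open Literature.Barriers.HodgeConjecture

namespace Summit.HodgeConjecture.CorCM.AndreProductForm

variable {K : Type} [Field K] [NumberField K] [IsCMField K] [IsGalois ℚ K]
variable {n : ℕ} {A : Fin n → AbelianVariety ℂ} (Φ : Fin n → CMType K) (ι : ∀ i, 𝓞 K →+* End (A i))
  {θ : ∀ i, K →+* Module.End ℂ (complexBetti (A i).X 1)}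

/-- **Milne 2020, Theorem 2 (= Deligne 1982 §5, the original form of André's theorem): `G^H = G^W`, with NO
hypothesis** — for the product `B = ⨁_{i<n} A_i` of realisations `(A_i, ι_i, θ_i)` of CM types `Φ_i` of one CM
field `K` Galois over `ℚ`, the subgroup of `∏ₖ GL(Hᵏ(B(ℂ); ℂ))` fixing all rational `(p,p)`-classes on all powers
EQUALS the subgroup fixing the divisor classes and the pulled-back split Weil classes on all powers.  The
Literature theorem `Milne1999.hodgeGroup_eq_weilStabilizer` at the tree's theorem
`andre1992_hodgeClasses_cmTypedProduct_mem_span_pullback_weilLines_holds`.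
[cite: Milne2020HodgeClassesAV, §4 Theorem 2 and Remark 1] [cite: Deligne1982HodgeCycles, §5]
[cite: Andre1992HodgeCM, Théorème (pp. 4–5)] -/
theorem hodgeGroup_eq_weilStabilizer (hA : ∀ i, IsCMTypeRealisation (Φ i) (A i) (ι i) (θ i)) :
    hodgeGroup (⨁ A).dim (⨁ A).X = weilStabilizer A Φ ι (⨁ A).dim (⨁ A).X :=
  Milne1999.hodgeGroup_eq_weilStabilizer Φ ι
    andre1992_hodgeClasses_cmTypedProduct_mem_span_pullback_weilLines_holds hA

/-- **Theorem 2 in the `GL × 𝔾_m` convention, with NO hypothesis**: `MT(B) =` the similitude form of `G^W`.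
[cite: Milne2020HodgeClassesAV, §4 Theorem 2] [cite: Milne1999LefschetzClasses, Def. 4.3 and p. 659] -/
theorem mumfordTateGroup_eq_weilSimilitudeGroup (hA : ∀ i, IsCMTypeRealisation (Φ i) (A i) (ι i) (θ i)) :
    mumfordTateGroup (⨁ A).dim (⨁ A).X = weilSimilitudeGroup A Φ ι (⨁ A).dim (⨁ A).X :=
  Milne1999.mumfordTateGroup_eq_weilSimilitudeGroup Φ ι
    andre1992_hodgeClasses_cmTypedProduct_mem_span_pullback_weilLines_holds hA

/-- **The use of Theorem 2, with NO hypothesis: a class on `B = ⨁ A_i` is fixed by every element of `G^W(ℂ)`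
iff it is fixed by every element of the Hodge group `Hg′(B)(ℂ)`.**
[cite: Milne2020HodgeClassesAV, §4 Theorem 2] [cite: Deligne1982HodgeCycles, §5 and I Prop. 3.1] -/
theorem forall_mem_weilStabilizer_apply_eq_iff (hA : ∀ i, IsCMTypeRealisation (Φ i) (A i) (ι i) (θ i))
    {k : ℕ} (x : complexBetti (⨁ A).X k) :
    (∀ g ∈ weilStabilizer A Φ ι (⨁ A).dim (⨁ A).X, g k x = x) ↔
      ∀ g ∈ hodgeGroup (⨁ A).dim (⨁ A).X, g k x = x :=
  Milne1999.forall_mem_weilStabilizer_apply_eq_iff Φ ι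
    andre1992_hodgeClasses_cmTypedProduct_mem_span_pullback_weilLines_holds hA x

/-- **`Hg′(B) = G^W ≤ S(B)`, with NO hypothesis** (the second step is Milne 1999 Prop. 4.8's `Hg′ ≤ S`).
[cite: Milne2020HodgeClassesAV, §4 Theorem 2] [cite: Milne1999LefschetzClasses, Prop. 4.8 (p. 660)] -/
theorem hodgeGroup_le_weilStabilizer_le_specialLefschetzGroup
    (hA : ∀ i, IsCMTypeRealisation (Φ i) (A i) (ι i) (θ i)) :
    hodgeGroup (⨁ A).dim (⨁ A).X = weilStabilizer A Φ ι (⨁ A).dim (⨁ A).X ∧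
      weilStabilizer A Φ ι (⨁ A).dim (⨁ A).X ≤ specialLefschetzGroup (⨁ A).dim (⨁ A).X :=
  Milne1999.hodgeGroup_le_weilStabilizer_le_specialLefschetzGroup Φ ι
    andre1992_hodgeClasses_cmTypedProduct_mem_span_pullback_weilLines_holds hA

end Summit.HodgeConjecture.CorCM.AndreProductForm

end
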